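import Summits.ResolutionOfSingularities.ResolutionOfSingularities.Theorems.EquisingularLiftEquisingularLiftNatRatLiftLiftableCentre
import Summits.ResolutionOfSingularities.ResolutionOfSingularities.Theorems.EquisingularLiftEquisingularLiftNatRatLiftMonomialCurves
import Summits.ResolutionOfSingularities.ResolutionOfSingularities.Theorems.EquisingularLiftEquisingularLiftNatRatLiftRegular
import Mathlib
import HarnessLib

/-!
# [OURS · L1 W4.5(b) · EL♮(3)] T-RATLIFT-ALG, PART 6 — SPECIMENS COMPOSED: the rational quartic and every monomial curve `C_e ⊂ ℙ³_k`
# (`e ≥ 3`) ARE LIFTABLE CENTRES — unconditionally over every perfect field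
# (crux `EquisingularLiftNatThree` = stmt-ResolutionOfSingularities-20148; PLANNER-MEMO-g10-1 class C3a — carriers beyond `ci`/`det`;
# composition of this seat's parts 4–5 with res-type-051's `SatLift` (p530902) and T-RATREG `RatReg` (p534148))

NOT a statement of any manuscript. Helper file of the chain res-L1-w45b (cell `res-hironaka`, rung L, slot W4.5(b)); OURS; AI-written,
weaker than expert review; def-free, no `sorry`, standard axioms; `--supports stmt-ResolutionOfSingularities-20148 --as helper` (counted 0).

* **`quartic_isLiftableCentre`** / `quartic_isLiftableCentre_setOf` — `k` perfect; `Γ = V₊(ker (aeval (s⁴, s³t, st³, t⁴))) ⊂ ℙ³_k` with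
  `V(𝓘_Γ)` regular ⟹ `IsLiftableCentre k 3 Γ _` (part 5 `isLiftableCentre_of_forms` / `_setOf_forms` on part 4 `quartic_clause`, `m₀ = 2`);
* **`monomialCurve_isLiftableCentre_setOf`** — the same for every `C_e = (s^e, s^{e−1}t, st^{e−1}, t^e)`, `e ≥ 3`, `m₀ = e − 2`;
* **`quartic_isLiftableCentre_of_clause (k) [PerfectField k]`** and **`monomialCurve_isLiftableCentre_of_clause (k) [PerfectField k] (he : 3 ≤ e)`**
  — UNCONDITIONAL: the regularity input is discharged from the same clause by res-type-051's
  `RatReg.isRegular_subscheme_vanishingIdeal_of_clause'` (p534148), closedness by `isClosed_setOf_ideal_le` ⇒ `IsLiftableCentre k 3 Γ _`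
  with NO hypotheses beyond the field: an infinite family of kernel-certified liftable centres outside the `ci`/`det` constructors
  (`C_e` is not arithmetically Cohen–Macaulay for `e ≥ 4`).

References: parts 4–5 of this series; res-type-051 SatLift (p530902) / T-RATREG (p534148); all OURS.
-/

set_option linter.dupNamespace false -- mandated namespace `Summit.<Summit>.<Problem>` of this single-conjunct summit

noncomputable section

open CategoryTheory AlgebraicGeometry TopologicalSpace
open MvPolynomial
open Literature.AlgebraicGeometry.Resolution

namespace Summit.ResolutionOfSingularities.ResolutionOfSingularities.Cruxes.EquisingularLiftNat.Sections

namespace RatLift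

/-- **SPECIMEN — the smooth rational quartic `(s⁴ : s³t : st³ : t⁴) ⊂ ℙ³_k`** (PLANNER-MEMO-g10-1 class C3a; non-ACM, not a complete
intersection, not determinantal): `IsRegular V(𝓘_Γ) ⇒ IsLiftableCentre k 3 Γ hΓ` for its zero set `Γ = V₊(ker (aeval (s⁴, s³t, st³, t⁴)))`
(part 4 `quartic_clause`, `m₀ = 2`). [OURS · L1 W4.5b] -/
theorem quartic_isLiftableCentre (k : Type) [Field k] [PerfectField k]
    (Z : Set (Literature.AlgebraicGeometry.Motives.projectiveSpace 3 k).left) (hZ : IsClosed Z)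
    (hZ𝔭 : letI := MvPolynomial.gradedAlgebra (σ := Fin (3 + 1)) (R := k)
      Z = {y : Proj (homogeneousSubmodule (Fin (3 + 1)) k) |
        RingHom.ker (aeval (R := k) (![X 0 ^ 4, X 0 ^ 3 * X 1, X 0 * X 1 ^ 3, X 1 ^ 4] : Fin 4 → MvPolynomial (Fin 2) k)) ≤
          (y : ProjectiveSpectrum (homogeneousSubmodule (Fin (3 + 1)) k)).asHomogeneousIdeal.toIdeal})
    (hZreg : Scheme.IsRegular (Scheme.IdealSheafData.vanishingIdeal
      (⟨Z, hZ⟩ : Closeds (Literature.AlgebraicGeometry.Motives.projectiveSpace 3 k).left)).subscheme) :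
    IsLiftableCentre k 3 Z hZ :=
  isLiftableCentre_of_forms k 3 _ (by norm_num) (quartic_isHomogeneous k) (quartic_clause k) Z hZ hZ𝔭 hZreg


/-- **`Z`-literal form for the quartic**: `Γ := {y | ker (aeval (s⁴, s³t, st³, t⁴)) ≤ 𝔮_y} ⊂ ℙ³_k`; `IsRegular V(𝓘_Γ) ⇒
IsLiftableCentre k 3 Γ _` (closedness by `isClosed_setOf_ideal_le`). [OURS · L1 W4.5b] -/
theorem quartic_isLiftableCentre_setOf (k : Type) [Field k] [PerfectField k]
    (hZreg : letI := MvPolynomial.gradedAlgebra (σ := Fin (3 + 1)) (R := k)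
      Scheme.IsRegular (Scheme.IdealSheafData.vanishingIdeal
        (⟨{y : Proj (homogeneousSubmodule (Fin (3 + 1)) k) |
            RingHom.ker (aeval (R := k) (![X 0 ^ 4, X 0 ^ 3 * X 1, X 0 * X 1 ^ 3, X 1 ^ 4] : Fin 4 → MvPolynomial (Fin 2) k)) ≤
              (y : ProjectiveSpectrum (homogeneousSubmodule (Fin (3 + 1)) k)).asHomogeneousIdeal.toIdeal},
          isClosed_setOf_ideal_le k 3 _⟩ : Closeds (Literature.AlgebraicGeometry.Motives.projectiveSpace 3 k).left)).subscheme) :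
    letI := MvPolynomial.gradedAlgebra (σ := Fin (3 + 1)) (R := k)
    IsLiftableCentre k 3
      {y : Proj (homogeneousSubmodule (Fin (3 + 1)) k) |
        RingHom.ker (aeval (R := k) (![X 0 ^ 4, X 0 ^ 3 * X 1, X 0 * X 1 ^ 3, X 1 ^ 4] : Fin 4 → MvPolynomial (Fin 2) k)) ≤
          (y : ProjectiveSpectrum (homogeneousSubmodule (Fin (3 + 1)) k)).asHomogeneousIdeal.toIdeal}
      (isClosed_setOf_ideal_le k 3 _) :=
  isLiftableCentre_setOf_forms k 3 _ (by norm_num) (quartic_isHomogeneous k) (quartic_clause k) hZreg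


section MonomialCurveLift

/-- **EVERY MONOMIAL CURVE `C_e ⊂ ℙ³_k` (`e ≥ 3`) WITH REGULAR TRACE IS A LIFTABLE CENTRE** (`k` perfect; part 5
`isLiftableCentre_setOf_forms` with `m₀ = e − 2`). The regularity input is discharged from the same clause by res-type-051's T-RATREG.
[OURS · L1 W4.5b] -/
theorem monomialCurve_isLiftableCentre_setOf (k : Type) [Field k] [PerfectField k] {e : ℕ} (he : 3 ≤ e)
    (hZreg : letI := MvPolynomial.gradedAlgebra (σ := Fin (3 + 1)) (R := k)
      Scheme.IsRegular (Scheme.IdealSheafData.vanishingIdeal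
        (⟨{y : Proj (homogeneousSubmodule (Fin (3 + 1)) k) |
            RingHom.ker (aeval (R := k)
              (![X 0 ^ e, X 0 ^ (e - 1) * X 1, X 0 * X 1 ^ (e - 1), X 1 ^ e] : Fin 4 → MvPolynomial (Fin 2) k)) ≤
              (y : ProjectiveSpectrum (homogeneousSubmodule (Fin (3 + 1)) k)).asHomogeneousIdeal.toIdeal},
          isClosed_setOf_ideal_le k 3 _⟩ : Closeds (Literature.AlgebraicGeometry.Motives.projectiveSpace 3 k).left)).subscheme) :
    letI := MvPolynomial.gradedAlgebra (σ := Fin (3 + 1)) (R := k)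
    IsLiftableCentre k 3
      {y : Proj (homogeneousSubmodule (Fin (3 + 1)) k) |
        RingHom.ker (aeval (R := k)
          (![X 0 ^ e, X 0 ^ (e - 1) * X 1, X 0 * X 1 ^ (e - 1), X 1 ^ e] : Fin 4 → MvPolynomial (Fin 2) k)) ≤
          (y : ProjectiveSpectrum (homogeneousSubmodule (Fin (3 + 1)) k)).asHomogeneousIdeal.toIdeal}
      (isClosed_setOf_ideal_le k 3 _) :=
  isLiftableCentre_setOf_forms k 3 _ (by omega) (monomialCurve_isHomogeneous k (by omega)) (monomialCurve_clause k he) hZreg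

end MonomialCurveLift

section Unconditional

/-- **THE SMOOTH RATIONAL QUARTIC `(s⁴ : s³t : st³ : t⁴) ⊂ ℙ³_k` IS A LIFTABLE CENTRE** (`k` perfect; no further hypotheses).
[OURS · L1 W4.5b] -/
theorem quartic_isLiftableCentre_of_clause (k : Type) [Field k] [PerfectField k] :
    letI := MvPolynomial.gradedAlgebra (σ := Fin (3 + 1)) (R := k)
    IsLiftableCentre k 3
      {y : Proj (homogeneousSubmodule (Fin (3 + 1)) k) |
        RingHom.ker (aeval (R := k) (![X 0 ^ 4, X 0 ^ 3 * X 1, X 0 * X 1 ^ 3, X 1 ^ 4] : Fin 4 → MvPolynomial (Fin 2) k)) ≤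
          (y : ProjectiveSpectrum (homogeneousSubmodule (Fin (3 + 1)) k)).asHomogeneousIdeal.toIdeal}
      (isClosed_setOf_ideal_le k 3 _) :=
  quartic_isLiftableCentre_setOf k
    (RatReg.isRegular_subscheme_vanishingIdeal_of_clause'
      (f := (![X 0 ^ 4, X 0 ^ 3 * X 1, X 0 * X 1 ^ 3, X 1 ^ 4] : Fin 4 → MvPolynomial (Fin 2) k))
      (he := by norm_num) (hf' := quartic_isHomogeneous k) (hcl := quartic_clause k)
      (hZ := isClosed_setOf_ideal_le k 3 _) (hZ𝔭 := rfl))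


/-- **EVERY MONOMIAL CURVE `C_e = (s^e : s^{e-1}t : st^{e-1} : t^e) ⊂ ℙ³_k`, `e ≥ 3`, IS A LIFTABLE CENTRE** (`k` perfect; no further
hypotheses). [OURS · L1 W4.5b] -/
theorem monomialCurve_isLiftableCentre_of_clause (k : Type) [Field k] [PerfectField k] {e : ℕ} (he : 3 ≤ e) :
    letI := MvPolynomial.gradedAlgebra (σ := Fin (3 + 1)) (R := k)
    IsLiftableCentre k 3
      {y : Proj (homogeneousSubmodule (Fin (3 + 1)) k) |
        RingHom.ker (aeval (R := k)
          (![X 0 ^ e, X 0 ^ (e - 1) * X 1, X 0 * X 1 ^ (e - 1), X 1 ^ e] : Fin 4 → MvPolynomial (Fin 2) k)) ≤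
          (y : ProjectiveSpectrum (homogeneousSubmodule (Fin (3 + 1)) k)).asHomogeneousIdeal.toIdeal}
      (isClosed_setOf_ideal_le k 3 _) :=
  monomialCurve_isLiftableCentre_setOf k he
    (RatReg.isRegular_subscheme_vanishingIdeal_of_clause'
      (f := (![X 0 ^ e, X 0 ^ (e - 1) * X 1, X 0 * X 1 ^ (e - 1), X 1 ^ e] : Fin 4 → MvPolynomial (Fin 2) k))
      (he := by omega) (hf' := monomialCurve_isHomogeneous k (by omega)) (hcl := monomialCurve_clause k he)
      (hZ := isClosed_setOf_ideal_le k 3 _) (hZ𝔭 := rfl))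

end Unconditional

end RatLift

end Summit.ResolutionOfSingularities.ResolutionOfSingularities.Cruxes.EquisingularLiftNat.Sections

end
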